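import Summits.QuantumFields.YangMills.Theorems.BalabanUVNodesN15TwoSpacingGluingInputLocalized
import HarnessLib

/-!
# THE GLUING STEP AT TWO LATTICE SPACINGS, XVIII: CUT ROWS — the remainder's commutator rows and the glued letters for an UNLOCALIZED cube operator `N_□` (the object the locality
# `M_h∘Δ_a∘N_□ = M_h` holds for — dag-n15-a's symmetric `neumannCubeG`) from the letters of the CUT object `M_{χ_□}∘N_□` and of `M_{χ_□}∘∇^±_μ∘N_□` (their N-IIIb∕N-IIIc shapes), the
# partition's coefficients being supported in `{χ_□ = 1}`; plus the nonlocal part through a ONE-SIDED letter of `N_□` (dag-n15-c g11, FILE 63 = WANT-n15-c (ii) of dag-n15-a g19 l.28442;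
# N15 = NE2, s1 «background-layer OPERATOR ingredient»; generic)

Cell `pub-ymgap`, seat `pub-ymgap-dag-n15-c` (R134 (a); HUMAN RULING D-0062), generation 11.  `bears_on: R4∕N15 · K3⁷ SpineGivenEndpointR13SepCoPH (stmt-QuantumFields-20544)`.
Filed `--supports stmt-QuantumFields-20544 --as helper` — COUNT-NEUTRAL.  Theorems only (0 `def`, 0 `sorry`).  Imports BY NAME FILE 57 `…N15TwoSpacingGluingInputLocalized` (through it FILES
43–46∕48∕49∕51∕56); nothing in the tree is modified.

WHY.  dag-n15-a's cube propagator at `U ≡ 1` is the symmetric extension `N_□ = Sym∘G∘M_{χ°}` (output NOT localized); `hloc` holds for IT (N-IIIa), while their letters are for the CUT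
`M_{χ_□}∘N_□` and `M_{χ_□}∘∇_ν∘N_□` (N-IIIb∕c).  A sharp cut-off cannot be differentiated (`∇(M_χN)` carries the jump), so FILES 45∕46∕48's two-sided hypotheses on `G_□` itself do not
fit either object.  THIS FILE inserts `M_χ` BEHIND the partition's coefficients instead: ★ `parametrix_cut` — `M_h∘M_χ = M_h ⟹ parametrix h (M_χ∘N) = parametrix h N`; ★
`hasMaj_comp_exp_in'` — global-after-ONE-SIDED-localized composition; ★★ `hasMaj_commOp_lapOp_comp_of_cut` — FILE 46's (2.134) row `[Σ∇*∇ + W, M_h]∘N ≤ 1_S1_S(|J|(c₂β + 2c₁β₁) + θ_W)e^{−δd}`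
from the CUT rows `M_χ∘N`, `M_χ∘∇_μ∘N`, `M_χ∘∇⁻_μ∘N` and the supports `M_{∇*∇h} = M_{∇*∇h}∘M_χ`, `M_{∇h} = M_{∇h}∘M_χ`, `M_{∇⁻h} = M_{∇⁻h}∘M_χ`; ★★ `hasMaj_commOp_comp_of_add_cut` — the
input-localized row of `Δ_loc + N_L` (FILE 57 `hasMaj_commOp_comp_of_add` with the cube letter ONE-SIDED `N_□ ≤ 1_S(y′)β′e^{−δd}` for the nonlocal composition); ★★★ `hasMaj_glued_of_cutRows`
(one grid) and ★★★ `hasMaj_idef_glued_of_cutRows` (two grids) — FILES 45∕57's glued letters with cut parametrix letters and input-localized remainder rows.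

HONEST FRAMING ∕ LIMITS.  Block-majorant bookkeeping ([B6] (2.36)–(2.37) p.229, (2.91)–(2.92) p.239, (2.133)–(2.136) p.247; [B5] (1.120)–(1.128) pp.37–38 = SHAPES ∕ MECHANISM); every row
displayed; nothing of [B5]∕[B6]∕[B9] asserted.  NE2⁺ NOT PRINTED, NOT proved; N15 NOT discharged; counts of record UNMOVED (typed 28∕28 · discharged 5∕27); one finite 𝕋⁴ at fixed ε
— NOT infinite volume, NOT OS on ℝ⁴, NOT a mass gap, NOT Clay; R4 closes the conditional finite-𝕋⁴ rung `BalabanLadder.UV` only.  Restate-immune (no Theses import).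
-/

noncomputable section

namespace Summit.QuantumFields.YangMills.BalabanUVNodes.N15.Gluing

open Literature.MathematicalPhysics.QuantumFieldTheory.Balaban1983to89
open Literature.MathematicalPhysics.QuantumFieldTheory.Balaban1983to89.B11SectG (BlockNorm HasMaj RowSum hasMaj_comp conv_exp_le)
open Literature.MathematicalPhysics.QuantumFieldTheory.Balaban1983to89.T4EtaRateDefect (idef)
open Literature.MathematicalPhysics.QuantumFieldTheory.Balaban1983to89.T4EtaRateCoeffDefect (pull)
open Literature.MathematicalPhysics.QuantumFieldTheory.Balaban1983to89.B6RandomWalk (Triangle254)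
open Literature.MathematicalPhysics.QuantumFieldTheory.Balaban1983to89.B6Prop26Gluing (mulOp ind ind_nonneg ind_le_one)
open Summit.QuantumFields.YangMills.BalabanUVNodes.N15.BackgroundLayer (fgrad fgradAdj bgrad)

/-! ## §1 Cut parametrix; global after one-sided -/

section Cut

variable {X : Type} {K : Type} [Fintype K]

/-- ★ `M_{h_□}∘M_{χ_□} = M_{h_□}` ⟹ the parametrix does not see the cut: `parametrix h (M_χ∘N) = parametrix h N`. [folklore] -/
theorem parametrix_cut {h χ : K → X → ℝ} {G : K → (X → ℝ) →ₗ[ℝ] (X → ℝ)} (hcut : ∀ i, mulOp (h i) ∘ₗ mulOp (χ i) = mulOp (h i)) :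
    parametrix h (fun i => mulOp (χ i) ∘ₗ G i) = parametrix h G := by
  unfold parametrix
  refine Finset.sum_congr rfl fun i _ => ?_
  rw [LinearMap.comp_assoc (mulOp (h i)) (G i) (mulOp (χ i)), ← LinearMap.comp_assoc (G i ∘ₗ mulOp (h i)) (mulOp (χ i)) (mulOp (h i)), hcut i]

end Cut

section OneSided

variable {g : B6.Geometry} {F₁ F₃ : Type} [AddCommGroup F₁] [Module ℝ F₁] [AddCommGroup F₃] [Module ℝ F₃] {b₁ : BlockNorm g F₁} {b₃ : BlockNorm g F₃}
  {X₂ : Type} [Fintype X₂] (blk₂ : X₂ → g.Site)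

/-- ★ **GLOBAL AFTER ONE-SIDED LOCALIZED**: `T₁ ≤ a₁e^{−ρ₁d}`, `T₂ ≤ 1_S(y′)·a₂e^{−ρ₂d}`, `ρ ≤ ρ₂`, `ρ + σ ≤ ρ₁` ⟹ `T₁∘T₂ ≤ 1_S(y′)·a₁a₂c·e^{−ρd}`. [cite: Balaban1984PropagatorsII, (2.52)–(2.56) pp.232–233 (mechanism)] -/
theorem hasMaj_comp_exp_in' {T₁ : (X₂ → ℝ) →ₗ[ℝ] F₃} {T₂ : F₁ →ₗ[ℝ] (X₂ → ℝ)} {S : Set g.Site} {a₁ a₂ ρ₁ ρ₂ ρ σ c : ℝ} (htri : Triangle254 g) (hd : ∀ a b : g.Site, 0 ≤ g.dist a b)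
    (hrow : RowSum g σ c) (ha₁ : 0 ≤ a₁) (ha₂ : 0 ≤ a₂) (hρ : 0 ≤ ρ) (hρ₂ : ρ ≤ ρ₂) (hρ₁ : ρ + σ ≤ ρ₁)
    (h₁ : HasMaj (BlockNorm.ofBlocks g blk₂) b₃ T₁ (fun a b => a₁ * Real.exp (-(ρ₁ * g.dist a b))))
    (h₂ : HasMaj b₁ (BlockNorm.ofBlocks g blk₂) T₂ (fun a b => ind S b * (a₂ * Real.exp (-(ρ₂ * g.dist a b))))) :
    HasMaj b₁ b₃ (T₁ ∘ₗ T₂) (fun a b => ind S b * (a₁ * a₂ * c * Real.exp (-(ρ * g.dist a b)))) := by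
  refine (hasMaj_comp h₁ h₂ fun a b => mul_nonneg ha₁ (Real.exp_nonneg _)).mono fun a b => ?_
  have hconv := conv_exp_le htri hd hrow hρ hρ₂ hρ₁ a b
  rw [show (BlockNorm.ofBlocks g blk₂).κ = 1 from rfl]
  calc ∑ y'' : g.Site, a₁ * Real.exp (-(ρ₁ * g.dist a y'')) * (1 * (ind S b * (a₂ * Real.exp (-(ρ₂ * g.dist y'' b)))))
      = ind S b * (a₁ * a₂) * ∑ y'' : g.Site, Real.exp (-(ρ₁ * g.dist a y'')) * Real.exp (-(ρ₂ * g.dist y'' b)) := by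
        rw [Finset.mul_sum]; exact Finset.sum_congr rfl fun y'' _ => by ring
    _ ≤ ind S b * (a₁ * a₂) * (c * Real.exp (-(ρ * g.dist a b))) := mul_le_mul_of_nonneg_left hconv (mul_nonneg (ind_nonneg _ _) (mul_nonneg ha₁ ha₂))
    _ = _ := by ring

end OneSided

/-! ## §2 The (2.134) row from CUT rows -/

section CutRows

variable {X : Type} [Fintype X] {J : Type} [Fintype J] {g : B6.Geometry} (blk : X → g.Site) {σ cr : ℝ}

/-- ★★ **THE (2.134) LETTER FROM CUT CUBE ROWS**: for an unlocalized `N` with cut rows `M_χ∘N ≤ 1_S1_Sβe^{−δd}`, `M_χ∘∇_μ∘N, M_χ∘∇⁻_μ∘N ≤ 1_S1_Sβ₁e^{−δd}` and a partition function `h` whose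
coefficients `∇*∇h, ∇h, ∇⁻h` are supported in `{χ = 1}` (`M_a = M_a∘M_χ`): `[Σ_μ∇*_μ∇_μ + W, M_h]∘N ≤ 1_S1_S·(|J|(c₂β + 2c₁β₁) + θ_W)e^{−δd}` — FILE 46 `hasMaj_commOp_lapOp_comp`'s conclusion verbatim.
[cite: Balaban1984PropagatorsII, (2.133)–(2.134) p.247 (shapes + mechanism)] -/
theorem hasMaj_commOp_lapOp_comp_of_cut {n : ℝ} {e : J → X ≃ X} {W N : (X → ℝ) →ₗ[ℝ] (X → ℝ)} {h χ : X → ℝ} {S : Set g.Site} {β β₁ c₁ c₂ θW δ : ℝ}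
    (hc₁ : 0 ≤ c₁) (hc₂ : 0 ≤ c₂)
    (hh1 : ∀ μ x, |fgrad n (e μ) h x| ≤ c₁) (hh1b : ∀ μ x, |bgrad n (e μ) h x| ≤ c₁) (hh2 : ∀ μ x, |fgradAdj n (e μ) (fgrad n (e μ) h) x| ≤ c₂)
    (hs2 : ∀ μ, mulOp (fgradAdj n (e μ) (fgrad n (e μ) h)) ∘ₗ mulOp χ = mulOp (fgradAdj n (e μ) (fgrad n (e μ) h)))
    (hs1 : ∀ μ, mulOp (fgrad n (e μ) h) ∘ₗ mulOp χ = mulOp (fgrad n (e μ) h)) (hs1b : ∀ μ, mulOp (bgrad n (e μ) h) ∘ₗ mulOp χ = mulOp (bgrad n (e μ) h))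
    (hGc : HasMaj (BlockNorm.ofBlocks g blk) (BlockNorm.ofBlocks g blk) (mulOp χ ∘ₗ N) (fun y y' => ind S y * ind S y' * (β * Real.exp (-(δ * g.dist y y')))))
    (hDc : ∀ μ, HasMaj (BlockNorm.ofBlocks g blk) (BlockNorm.ofBlocks g blk) (mulOp χ ∘ₗ (fgrad n (e μ) ∘ₗ N))
      (fun y y' => ind S y * ind S y' * (β₁ * Real.exp (-(δ * g.dist y y')))))
    (hDbc : ∀ μ, HasMaj (BlockNorm.ofBlocks g blk) (BlockNorm.ofBlocks g blk) (mulOp χ ∘ₗ (bgrad n (e μ) ∘ₗ N))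
      (fun y y' => ind S y * ind S y' * (β₁ * Real.exp (-(δ * g.dist y y')))))
    (hW : HasMaj (BlockNorm.ofBlocks g blk) (BlockNorm.ofBlocks g blk) (commOp W h ∘ₗ N) (fun y y' => ind S y * ind S y' * (θW * Real.exp (-(δ * g.dist y y'))))) :
    HasMaj (BlockNorm.ofBlocks g blk) (BlockNorm.ofBlocks g blk) (commOp (lapOp n e W) h ∘ₗ N)
      (fun y y' => ind S y * ind S y' * ((Fintype.card J * (c₂ * β + 2 * (c₁ * β₁)) + θW) * Real.exp (-(δ * g.dist y y')))) := by
  -- insert the cut behind each coefficient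
  have ins : ∀ (a : X → ℝ) (T : (X → ℝ) →ₗ[ℝ] (X → ℝ)), mulOp a ∘ₗ mulOp χ = mulOp a → mulOp a ∘ₗ T = mulOp a ∘ₗ (mulOp χ ∘ₗ T) := fun a T ha => by
    rw [← LinearMap.comp_assoc, ha]
  have hterm : ∀ μ, HasMaj (BlockNorm.ofBlocks g blk) (BlockNorm.ofBlocks g blk)
      (mulOp (fgradAdj n (e μ) (fgrad n (e μ) h)) ∘ₗ N - mulOp (fgrad n (e μ) h) ∘ₗ (fgrad n (e μ) ∘ₗ N) - mulOp (bgrad n (e μ) h) ∘ₗ (bgrad n (e μ) ∘ₗ N))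
      (fun y y' => ind S y * ind S y' * ((c₂ * β + 2 * (c₁ * β₁)) * Real.exp (-(δ * g.dist y y')))) := fun μ => by
    rw [ins _ N (hs2 μ), ins _ (fgrad n (e μ) ∘ₗ N) (hs1 μ), ins _ (bgrad n (e μ) ∘ₗ N) (hs1b μ)]
    have t0 := hasMaj_mulOp_comp_loc blk hc₂ (hh2 μ) hGc
    have t1 := hasMaj_mulOp_comp_loc blk hc₁ (hh1 μ) (hDc μ)
    have t2 := hasMaj_mulOp_comp_loc blk hc₁ (hh1b μ) (hDbc μ)
    refine ((t0.sub t1).sub t2).mono fun y y' => le_of_eq ?_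
    ring
  have hsum := hasMaj_fsum (b₁ := BlockNorm.ofBlocks g blk) (b₃ := BlockNorm.ofBlocks g blk) Finset.univ _ _ fun μ _ => hterm μ
  rw [commOp_lapOp_comp]
  refine (hsum.add hW).mono fun y y' => le_of_eq ?_
  simp only [Finset.sum_const, Finset.card_univ, nsmul_eq_mul]
  ring

/-- ★★ **THE INPUT-LOCALIZED ROW OF `Δ_loc + N_L` WITH A ONE-SIDED CUBE LETTER**: the two-sided local row `θ₁` (e.g. ★★ above), the nonlocal commutator letter `[N_L, M_h] ≤ c_K e^{−ρ₁d}`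
(FILE 56) and the ONE-SIDED cube letter `N_□ ≤ 1_S(y′)·β′e^{−δd}` ⟹ `[Δ_loc + N_L, M_h]∘N_□ ≤ 1_S(y′)·(θ₁ + c_Kβ′c_r)·e^{−ρd}` (`0 ≤ ρ ≤ δ`, `ρ + σ ≤ ρ₁`).
[cite: Balaban1984PropagatorsI, (1.121) p.37, (1.128) p.38 (mechanism); Balaban1984PropagatorsII, (2.134) p.247 (shape)] -/
theorem hasMaj_commOp_comp_of_add_cut (htri : Triangle254 g) (hd : ∀ a b : g.Site, 0 ≤ g.dist a b) (hrow : RowSum g σ cr) {Δloc NL N : (X → ℝ) →ₗ[ℝ] (X → ℝ)} {h : X → ℝ}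
    {S : Set g.Site} {θ₁ cK β' δ ρ ρ₁ : ℝ} (hθ₁ : 0 ≤ θ₁) (hcK : 0 ≤ cK) (hβ' : 0 ≤ β') (hρ : 0 ≤ ρ) (hρδ : ρ ≤ δ) (hρ₁ : ρ + σ ≤ ρ₁)
    (hKloc : HasMaj (BlockNorm.ofBlocks g blk) (BlockNorm.ofBlocks g blk) (commOp Δloc h ∘ₗ N) (fun y y' => ind S y * ind S y' * (θ₁ * Real.exp (-(δ * g.dist y y')))))
    (hKN : HasMaj (BlockNorm.ofBlocks g blk) (BlockNorm.ofBlocks g blk) (commOp NL h) (fun y y' => cK * Real.exp (-(ρ₁ * g.dist y y'))))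
    (hN1 : HasMaj (BlockNorm.ofBlocks g blk) (BlockNorm.ofBlocks g blk) N (fun y y' => ind S y' * (β' * Real.exp (-(δ * g.dist y y'))))) :
    HasMaj (BlockNorm.ofBlocks g blk) (BlockNorm.ofBlocks g blk) (commOp (Δloc + NL) h ∘ₗ N) (fun y y' => ind S y' * ((θ₁ + cK * β' * cr) * Real.exp (-(ρ * g.dist y y')))) := by
  have t2 := hasMaj_comp_exp_in' blk htri hd hrow hcK hβ' hρ hρδ hρ₁ hKN hN1
  rw [commOp_add_left, LinearMap.add_comp]
  refine (hKloc.add t2).mono fun y y' => ?_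
  have hexp : Real.exp (-(δ * g.dist y y')) ≤ Real.exp (-(ρ * g.dist y y')) := Real.exp_le_exp.2 (by nlinarith [hd y y'])
  have h1 : ind S y * ind S y' * (θ₁ * Real.exp (-(δ * g.dist y y'))) ≤ ind S y' * (θ₁ * Real.exp (-(ρ * g.dist y y'))) := by
    have hy := ind_le_one S y
    have h0 : 0 ≤ ind S y' * (θ₁ * Real.exp (-(ρ * g.dist y y'))) := mul_nonneg (ind_nonneg _ _) (mul_nonneg hθ₁ (Real.exp_nonneg _))
    calc ind S y * ind S y' * (θ₁ * Real.exp (-(δ * g.dist y y'))) ≤ ind S y * ind S y' * (θ₁ * Real.exp (-(ρ * g.dist y y'))) :=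
          mul_le_mul_of_nonneg_left (mul_le_mul_of_nonneg_left hexp hθ₁) (mul_nonneg (ind_nonneg _ _) (ind_nonneg _ _))
      _ = ind S y * (ind S y' * (θ₁ * Real.exp (-(ρ * g.dist y y')))) := by ring
      _ ≤ 1 * (ind S y' * (θ₁ * Real.exp (-(ρ * g.dist y y')))) := mul_le_mul_of_nonneg_right hy h0
      _ = _ := one_mul _
  calc ind S y * ind S y' * (θ₁ * Real.exp (-(δ * g.dist y y'))) + ind S y' * (cK * β' * cr * Real.exp (-(ρ * g.dist y y')))
      ≤ ind S y' * (θ₁ * Real.exp (-(ρ * g.dist y y'))) + ind S y' * (cK * β' * cr * Real.exp (-(ρ * g.dist y y'))) := by linarith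
    _ = _ := by ring

end CutRows

/-! ## §3 The glued letters from cut rows -/

section Glued

variable {X X' : Type} [Fintype X] [Fintype X'] [DecidableEq X] [DecidableEq X'] {ι : Type} [Fintype ι] {g : B6.Geometry} (blk : X → g.Site) (π : X' → X)
  (S : ι → Set g.Site) {σ cr : ℝ}

omit [Fintype X'] [DecidableEq X'] in
/-- ★★★ **THE GLUED PROPAGATOR DECAYS, from cut rows (one grid)**: FILE 45 `hasMaj_glued_of_cubes` for unlocalized `G_□` with cut letters `M_{χ_□}∘G_□ ≤ 1_S1_Sβe^{−δd}`, `M_{h_□}∘M_{χ_□} = M_{h_□}`,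
and input-localized remainder rows. [cite: Balaban1984PropagatorsII, (2.91) p.239, (2.133)–(2.135) p.247 (mechanism)] -/
theorem hasMaj_glued_of_cutRows (htri : Triangle254 g) (hd : ∀ a b : g.Site, 0 ≤ g.dist a b) (hd0 : ∀ y : g.Site, g.dist y y = 0) (hrow : RowSum g σ cr) (hσ : 0 ≤ σ)
    {Δ : (X → ℝ) →ₗ[ℝ] (X → ℝ)} {h χ : ι → X → ℝ} {G : ι → (X → ℝ) →ₗ[ℝ] (X → ℝ)} {β θ₀ δ Nov : ℝ} (hβ : 0 ≤ β) (hθ : 0 ≤ θ₀) (hNov : 0 ≤ Nov) (hσδ : 2 * σ ≤ δ)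
    (hcut : ∀ i, mulOp (h i) ∘ₗ mulOp (χ i) = mulOp (h i)) (hh : ∀ i x, |h i x| ≤ 1) (hN : ∀ a, ∑ i, ind (S i) a ≤ Nov)
    (hGc : ∀ i, HasMaj (BlockNorm.ofBlocks g blk) (BlockNorm.ofBlocks g blk) (mulOp (χ i) ∘ₗ G i) (fun y y' => ind (S i) y * ind (S i) y' * (β * Real.exp (-(δ * g.dist y y')))))
    (hK : ∀ i, HasMaj (BlockNorm.ofBlocks g blk) (BlockNorm.ofBlocks g blk) (commOp Δ (h i) ∘ₗ G i) (fun y y' => ind (S i) y' * (θ₀ * Real.exp (-(δ * g.dist y y')))))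
    (hq : Nov * θ₀ * cr < 1) :
    HasMaj (BlockNorm.ofBlocks g blk) (BlockNorm.ofBlocks g blk) (glueInv (parametrix h G) (remainder Δ h G))
      (fun y y' => Nov * β * (1 - Nov * θ₀ * cr)⁻¹ * cr * Real.exp (-((δ - σ) * g.dist y y'))) := by
  have hP := hasMaj_parametrix blk S hβ hh hN hGc
  rw [parametrix_cut hcut] at hP
  exact hasMaj_glueInv blk htri hd hd0 hrow hσ (mul_nonneg hNov hβ) (mul_nonneg hNov hθ) hσδ hP (hasMaj_remainder_in blk S hθ hh hN hK) hq

/-- ★★★ **THE η-DEFECT OF THE GLUED PROPAGATOR FROM CUT ROWS** — FILE 57 `hasMaj_idef_glued_of_cubes_in` for UNLOCALIZED cube operators `G_□` (the objects `hloc` holds for, e.g.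
dag-n15-a's `neumannCubeG`) whose LETTERS are given for the CUT objects `M_{χ_□}∘G_□` (two-sided, `β`; their two-grid defects `m`) under `M_{h_□}∘M_{χ_□} = M_{h_□}` (so the parametrices
coincide: `parametrix_cut`), with INPUT-localized remainder rows `hK, hK′, hDK` for the uncut `G_□` (assembled by `hasMaj_commOp_comp_of_add_cut` below); same constants and smallness.
[cite: Balaban1984PropagatorsII, (2.36)–(2.37) p.229, (2.91)–(2.92) p.239, (2.133)–(2.136) p.247 (mechanism); Balaban1984PropagatorsI, (1.121)–(1.123) p.37] -/
theorem hasMaj_idef_glued_of_cutRows (htri : Triangle254 g) (hd : ∀ a b : g.Site, 0 ≤ g.dist a b) (hd0 : ∀ y : g.Site, g.dist y y = 0) (hrow : RowSum g σ cr) (hσ : 0 ≤ σ)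
    (hcr : 0 ≤ cr) {Δ : (X → ℝ) →ₗ[ℝ] (X → ℝ)} {Δ' : (X' → ℝ) →ₗ[ℝ] (X' → ℝ)} {h χ : ι → X → ℝ} {h' χ' : ι → X' → ℝ} {G : ι → (X → ℝ) →ₗ[ℝ] (X → ℝ)}
    {G' : ι → (X' → ℝ) →ₗ[ℝ] (X' → ℝ)} {β θ₀ m r o δ Nov : ℝ} (hβ : 0 ≤ β) (hθ : 0 ≤ θ₀) (hm : 0 ≤ m) (hr : 0 ≤ r) (ho : 0 ≤ o) (hNov : 0 ≤ Nov) (hσδ : 2 * σ ≤ δ)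
    (hcut : ∀ i, mulOp (h i) ∘ₗ mulOp (χ i) = mulOp (h i)) (hcut' : ∀ i, mulOp (h' i) ∘ₗ mulOp (χ' i) = mulOp (h' i)) (hh : ∀ i x, |h i x| ≤ 1) (hh' : ∀ i x', |h' i x'| ≤ 1) (hfit : ∀ i x', |h' i x' - h i (π x')| ≤ o) (hN : ∀ b, ∑ i, ind (S i) b ≤ Nov)
    (hGc : ∀ i, HasMaj (BlockNorm.ofBlocks g blk) (BlockNorm.ofBlocks g blk) (mulOp (χ i) ∘ₗ G i) (fun y y' => ind (S i) y * ind (S i) y' * (β * Real.exp (-(δ * g.dist y y')))))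
    (hGc' : ∀ i, HasMaj (BlockNorm.ofBlocks g (blk ∘ π)) (BlockNorm.ofBlocks g (blk ∘ π)) (mulOp (χ' i) ∘ₗ G' i)
      (fun y y' => ind (S i) y * ind (S i) y' * (β * Real.exp (-(δ * g.dist y y')))))
    (hK : ∀ i, HasMaj (BlockNorm.ofBlocks g blk) (BlockNorm.ofBlocks g blk) (commOp Δ (h i) ∘ₗ G i)
      (fun y y' => ind (S i) y' * (θ₀ * Real.exp (-(δ * g.dist y y')))))
    (hK' : ∀ i, HasMaj (BlockNorm.ofBlocks g (blk ∘ π)) (BlockNorm.ofBlocks g (blk ∘ π)) (commOp Δ' (h' i) ∘ₗ G' i)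
      (fun y y' => ind (S i) y' * (θ₀ * Real.exp (-(δ * g.dist y y')))))
    (hDGc : ∀ i, HasMaj (BlockNorm.ofBlocks g blk) (BlockNorm.ofBlocks g (blk ∘ π)) (idef (pull π) (pull π) (mulOp (χ' i) ∘ₗ G' i) (mulOp (χ i) ∘ₗ G i))
      (fun y y' => ind (S i) y * ind (S i) y' * (m * Real.exp (-(δ * g.dist y y')))))
    (hDK : ∀ i, HasMaj (BlockNorm.ofBlocks g blk) (BlockNorm.ofBlocks g (blk ∘ π)) (idef (pull π) (pull π) (commOp Δ' (h' i) ∘ₗ G' i) (commOp Δ (h i) ∘ₗ G i))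
      (fun y y' => ind (S i) y' * (r * Real.exp (-(δ * g.dist y y')))))
    (hq : Nov * θ₀ * cr < 1) :
    HasMaj (BlockNorm.ofBlocks g blk) (BlockNorm.ofBlocks g (blk ∘ π))
      (idef (pull π) (pull π) (glueInv (parametrix h' G') (remainder Δ' h' G')) (glueInv (parametrix h G) (remainder Δ h G)))
      (fun y y' => (Nov * β * ((1 - Nov * θ₀ * cr)⁻¹ * ((1 - Nov * θ₀ * cr)⁻¹ * (Nov * (θ₀ * o + r)) * cr) * cr) * cr +
        Nov * (2 * β * o + m) * (1 - Nov * θ₀ * cr)⁻¹ * cr) * Real.exp (-((δ - 2 * σ) * g.dist y y'))) :=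
  by
  have e0 := parametrix_cut (G := G) hcut
  have e0' := parametrix_cut (G := G') hcut'
  have hP' := hasMaj_parametrix (blk ∘ π) S hβ hh' hN hGc'
  have hIP := hasMaj_idef_parametrix blk π S hβ hm ho hh hh' hfit hN hGc hGc' hDGc
  rw [e0'] at hP'
  rw [e0, e0'] at hIP
  exact hasMaj_idef_glueInv blk π htri hd hd0 hrow hσ hcr (mul_nonneg hNov hβ) (mul_nonneg hNov hθ) (mul_nonneg hNov (by positivity)) (mul_nonneg hNov (by positivity)) hσδ
    hP' (hasMaj_remainder_in blk S hθ hh hN hK) (hasMaj_remainder_in (blk ∘ π) S hθ hh' hN hK') hIP (hasMaj_idef_remainder_in blk π S hθ hr ho hh hfit hN hK' hDK) hq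

end Glued

end Summit.QuantumFields.YangMills.BalabanUVNodes.N15.Gluing

end
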